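import Literature.MathematicalPhysics.QuantumFieldTheory.Balaban1983to89.B9

/-!
# `Balaban1983to89.B9SectBCodedCarrier` — a CODED BACKGROUND CARRIER for Sect. B's (U, U′ = e^{iηA′}) pairs, and the TRANSFER of
# `Thm32Printed` ∕ `Thm33Printed` ∕ `SectBStepPrinted` between a backgrounds record and its coding

T. Bałaban, *Propagators for lattice gauge theories in a background field*, Commun. Math. Phys. **99** (1985) 389–434
[`Balaban1985BackgroundPropagators`, "B9"], Sect. B pp. 400–407 (Theorem 3.4 p. 400; (3.35)–(3.37) p. 396).

statement-level skeleton of published theorems with citation tags; proofs where landed; nothing here is a claim about the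
Yang–Mills mass gap

THE PRINTED QUANTIFIER RANGES (verbatim).  Theorem 3.4, p. 400: *"There exists a positive constant a₁ such that the operators
G′(U), (Q′(U)G′²(U)Q′*(U))⁻¹, R(U), G(U) extend to configurations U′U for α₁ ≦ a₁ as analytic functions of A. The extended operators
satisfy all the inequalities of Theorems 3.1–3.3 correspondingly."*; (3.35) p. 396: *"U is a gauge field configuration on T_η with
values in G … for a configuration U there exists a gauge transformation u on □ such that U^u = e^{iηA} …"*; (3.37) p. 396: *"U′ =
e^{iηA′}, A′ 𝔤ᶜ-valued, |A′| < α₁(Lʲη)⁻¹, |∇^η_U A′| < α₁(Lʲη)⁻² on Ω_j"*.  So every Sect.-B hypothesis about the background —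
the unitarity of its bond variables, the sizes (3.19) of the transported averages Q′(U), Q′*(U), the sizes (3.58)–(3.59) of their
variations F′(A′) — is asked AT a `G`-valued configuration `U` of the class (3.35) and AT an `A′` of the class (3.37) with `α₁ ≦ a₁`.

WHY THIS FILE (pub-ymgap N06 row 13, seat dag-n06-c gen 7; LOCATED-6).  The letters dictionaries of the tree's Sect.-B step frames
(`B9SectBGpStepAtLettersV2.GpFrame₂` ⊂ `CinvFrame₂` ⊂ …, root of `B9SectBStepFrameV7.SectBFrame₇`) copy the shapes of r06's per-`U`
hypotheses as fields quantified over EVERY `U : (bg i).Cfg` and EVERY `α₁ > 0`: `unitary` (`‖U_b‖, ‖U_b⁻¹‖ ≦ 1`), the (3.19) sizes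
`w_nonneg`/`card_w`/`hkQ`/`hsQ`/`hQc`/`hQcs`, the (3.37)∕(3.58)∕(3.59) sizes `cplx`/`hF` (`∀ α₁ > 0`).  Over the record's carrier
`B9PinMembersKLevelV1.bg9Y` (`Cfg` = ALL `GL`-valued bond fields of the torus) these are not the printed hypotheses and, with the
genuine letters of NODE 00 (`Node00.OpsYDeltaPrimeA`), not satisfiable: a non-unitary bond variable has norm `> 1`, a transport along it
has norm `> 1`, and `|F′(A′)| = O(α₁)` is false for large `α₁`; the exact laws `mul_law` ((3.60)), `gop_eq`, `write342` forbid replacing the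
letters by tame ones off the class (every configuration is `e^{iηA′}·1`).  THE REPAIR OF THIS FILE restores print's ranges WITHOUT editing
the frames: the frames are instantiated over a CODED carrier `Coding.bg` whose configurations are `base U` (a configuration of the record),
`mult a` (a multiplier, presented by a code `a : A` of `U′ = decA a`, at the record: `A′` itself) and `prod U a` (the product `U′U`,
remembered as the pair); the regularity classes (3.35)∕(3.36) hold at `base U` only, the complex classes (3.37)∕(3.38) hold at the pairs
`(base U, mult a)` only and are a PARAMETER `C37`∕`C38` of the coding (the instance author's letters-form reading of (3.37), possibly
including `U` `G`-valued and `α₁ ≦ αcap`), `mul (mult a) (base U) = prod U a`.  Off these, every frame field is either vacuous or a size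
bound met by flat letters; on them the letters are NODE 00's genuine ones.  The kernel families ∕ kernels of the record are pulled back
along the decoding `dec` (`base U ↦ U`, `mult a ↦ decA a`, `prod U a ↦ (decA a)·U`), and §3 TRANSFERS the printed statements:
`Thm32Printed`∕`Thm33Printed` from the record to the coding (the frames' inputs), and ★ `SectBStepPrinted` from the coding back to the
record (the frames' output), under ONE displayed implication `hclass`: at a (3.35)-regular `U` above an `M`-threshold, the record's
(3.37) at `α₁ ≦ αcap` implies the coded class `C37 (r·α₁) U a` of some code `a` of `U′` (a rescaling `r > 0` of `α₁` is allowed: the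
step's conclusions do not mention `α₁`).  The analyticity predicate is pulled back as `pullAn` (`base U ↦ ∀ K, K′ = pullK K → IsAn K U (β/r)`).

WHAT IS IN THE FILE (0 sorry; standard axioms; `def`s = the coding data, the coded carrier, the three pullbacks).
§1 `CCfg`, `Coding` (`A`, `decA`, `C37`, `C38`), `Coding.dec`, `Coding.bg`, simp lemmas.  §2 `pullK`, `pullS`, `pullAn` and the
`Iff.rfl`-level transport of `Ineq342_346_347`, `Ineq343_345`, `Thms31to33IneqAt` along `dec`.  §3 ★ `thm32Printed_coded`,
★ `thm33Printed_coded` (record ⇒ coding), ★★ `sectBStepPrinted_of_coded` (coding ⇒ record, under `hclass`).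

HONEST SCOPE.  Quantifier bookkeeping; nothing of [B9] is asserted or proved; no operator is constructed; the coded carrier is a proof
device restoring print's hypothesis ranges for the tree's letters-level frames, not a new reading of (3.35)–(3.38).  COUNT-NEUTRAL; N06 NOT
discharged; one finite lattice programme — nothing continuum ∕ OS ∕ mass-gap ∕ Clay.  Cell `pub-ymgap` (HUMAN RULING D-0062), Track A
node N06 [B9], N06-ASSIGNMENT row 13, 2026-08-27.

RELATED IN THE TREE, NOT DUPLICATED: `B9` (`Backgrounds`, `KernelFamily`, `SiteKernel`, `Thm32Printed`, `Thm33Printed`, `SectBStepPrinted`,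
`Thms31to33IneqAt` — USED BY NAME); the frames `B9SectBGpStepAtLettersV2` … `B9SectBStepFrameV7` and the adapters
`Summits/…/BalabanUVNodesN06SectBOfFrameV7(R)` are NOT modified (their coded-carrier adapter is a separate Summits file).
-/

namespace Literature.MathematicalPhysics.QuantumFieldTheory.Balaban1983to89.B9SectBCodedCarrier

open Literature.MathematicalPhysics.QuantumFieldTheory.Balaban1983to89
open Literature.MathematicalPhysics.QuantumFieldTheory.Balaban1983to89.B9 (Backgrounds Geometry KernelFamily SiteKernel
  Ineq342_346_347 Ineq343_345 Thms31to33IneqAt Thm32Printed Thm33Printed SectBStepPrinted)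

/-! ## §1 The coded configurations and the coded backgrounds record -/

/-- **CODED CONFIGURATIONS** over a configuration type `C` with multiplier codes `A`: a configuration of the record (`base U`), a multiplier
`U′` presented by its code (`mult a`), or a product `U′U` remembered as the pair (`prod U a`).
[cite: Balaban1985BackgroundPropagators, Thm 3.4 p.400 («extend to configurations U′U»), (3.37) p.396 («U′ = e^{iηA′}»)] -/
inductive CCfg (C : Type) (A : Type) : Type
  | base : C → CCfg C A
  | mult : A → CCfg C A
  | prod : C → A → CCfg C A

/-- **A CODING of a backgrounds record** `B`: the type `A` of multiplier codes (at the record: the fields `A′` of (3.37)), their decoding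
`decA a = U′` (at the record: `e^{iηA′}`), and the coded complex classes `C37` ∕ `C38` — predicates of `(α₁, U, a)` standing for (3.37) ∕ (3.38)
in the letters form an instance consumes (the instance author's choice; related to the record's classes only through the hypothesis
`hclass` of `sectBStepPrinted_of_coded`). [cite: Balaban1985BackgroundPropagators, (3.37)–(3.38) p.396] -/
structure Coding (B : Backgrounds) where
  /-- the multiplier codes -/
  A : Type
  /-- the multiplier `U′` a code presents -/
  decA : A → B.Cfg
  /-- the coded class (3.37) at `(α₁, U, a)` -/
  C37 : ℝ → B.Cfg → A → Prop
  /-- the coded class (3.38) at `(α₁, U, a)` -/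
  C38 : ℝ → B.Cfg → A → Prop

namespace Coding

variable {B : Backgrounds} (𝔠 : Coding B)

/-- the DECODING of a coded configuration: `base U ↦ U`, `mult a ↦ decA a`, `prod U a ↦ (decA a)·U` (the record's product `U′U`).
[cite: Balaban1985BackgroundPropagators, Thm 3.4 p.400 (U′U)] -/
def dec : CCfg B.Cfg 𝔠.A → B.Cfg
  | .base U => U
  | .mult a => 𝔠.decA a
  | .prod U a => B.mul (𝔠.decA a) U

/-- **THE CODED BACKGROUNDS RECORD**: configurations `CCfg B.Cfg A`; `one = base 1`; `mul (mult a) (base U) = prod U a` (all other products are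
sent to `base 1` — they never occur under the classes); (3.35)∕(3.36) = the record's classes AT `base U` ONLY; (3.37)∕(3.38) = the coded classes AT
THE PAIRS `(base U, mult a)` ONLY. [cite: Balaban1985BackgroundPropagators, (3.35)–(3.38) p.396, Thm 3.4 p.400] -/
def bg : Backgrounds where
  Cfg := CCfg B.Cfg 𝔠.A
  one := .base B.one
  mul := fun c' c => match c', c with
    | .mult a, .base U => .prod U a
    | _, _ => .base B.one
  Reg335 := fun c α v => match v with
    | .base U => B.Reg335 c α U
    | _ => False
  Reg336 := fun c α v => match v with
    | .base U => B.Reg336 c α U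
    | _ => False
  Cplx337 := fun α v w => match v, w with
    | .base U, .mult a => 𝔠.C37 α U a
    | _, _ => False
  Cplx338 := fun α v w => match v, w with
    | .base U, .mult a => 𝔠.C38 α U a
    | _, _ => False

/-- `dec (base U) = U`. [cite: Balaban1985BackgroundPropagators, (3.35) p.396, bookkeeping] -/
@[simp] theorem dec_base (U : B.Cfg) : 𝔠.dec (.base U) = U := rfl

/-- `dec (mult a) = decA a`. [cite: Balaban1985BackgroundPropagators, (3.37) p.396, bookkeeping] -/
@[simp] theorem dec_mult (a : 𝔠.A) : 𝔠.dec (.mult a) = 𝔠.decA a := rfl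

/-- `dec (prod U a) = (decA a)·U`. [cite: Balaban1985BackgroundPropagators, Thm 3.4 p.400, bookkeeping] -/
@[simp] theorem dec_prod (U : B.Cfg) (a : 𝔠.A) : 𝔠.dec (.prod U a) = B.mul (𝔠.decA a) U := rfl

/-- the coded product of a multiplier and a base configuration is the remembered pair. [cite: Balaban1985BackgroundPropagators, Thm 3.4 p.400, bookkeeping] -/
@[simp] theorem bg_mul_mult_base (a : 𝔠.A) (U : B.Cfg) : 𝔠.bg.mul (.mult a) (.base U) = .prod U a := rfl

/-- decoding the coded product gives the record's product `U′U`. [cite: Balaban1985BackgroundPropagators, Thm 3.4 p.400, bookkeeping] -/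
theorem dec_bg_mul_mult_base (a : 𝔠.A) (U : B.Cfg) : 𝔠.dec (𝔠.bg.mul (.mult a) (.base U)) = B.mul (𝔠.decA a) U := rfl

/-- (3.35) of the coding at a base configuration IS the record's (3.35). [cite: Balaban1985BackgroundPropagators, (3.35) p.396, bookkeeping] -/
@[simp] theorem bg_Reg335_base (c α : ℝ) (U : B.Cfg) : 𝔠.bg.Reg335 c α (.base U) ↔ B.Reg335 c α U := Iff.rfl

/-- (3.35) of the coding never holds at a multiplier. [cite: Balaban1985BackgroundPropagators, (3.35) p.396, bookkeeping] -/
@[simp] theorem bg_Reg335_mult (c α : ℝ) (a : 𝔠.A) : ¬ 𝔠.bg.Reg335 c α (.mult a) := fun h => h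

/-- (3.35) of the coding never holds at a product. [cite: Balaban1985BackgroundPropagators, (3.35) p.396, bookkeeping] -/
@[simp] theorem bg_Reg335_prod (c α : ℝ) (U : B.Cfg) (a : 𝔠.A) : ¬ 𝔠.bg.Reg335 c α (.prod U a) := fun h => h

/-- (3.36) of the coding at a base configuration IS the record's (3.36). [cite: Balaban1985BackgroundPropagators, (3.36) p.396, bookkeeping] -/
@[simp] theorem bg_Reg336_base (c α : ℝ) (U : B.Cfg) : 𝔠.bg.Reg336 c α (.base U) ↔ B.Reg336 c α U := Iff.rfl

/-- (3.37) of the coding at a pair `(base U, mult a)` IS the coded class `C37`. [cite: Balaban1985BackgroundPropagators, (3.37) p.396, bookkeeping] -/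
@[simp] theorem bg_Cplx337_base_mult (α : ℝ) (U : B.Cfg) (a : 𝔠.A) : 𝔠.bg.Cplx337 α (.base U) (.mult a) ↔ 𝔠.C37 α U a := Iff.rfl

/-- (3.38) of the coding at a pair `(base U, mult a)` IS the coded class `C38`. [cite: Balaban1985BackgroundPropagators, (3.38) p.396, bookkeeping] -/
@[simp] theorem bg_Cplx338_base_mult (α : ℝ) (U : B.Cfg) (a : 𝔠.A) : 𝔠.bg.Cplx338 α (.base U) (.mult a) ↔ 𝔠.C38 α U a := Iff.rfl

/-- (3.37) of the coding holds ONLY at pairs `(base U, mult a)`: from `Cplx337 α v w` one recovers `v = base U`, `w = mult a` with `C37 α U a`.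
[cite: Balaban1985BackgroundPropagators, (3.37) p.396, bookkeeping] -/
theorem exists_of_bg_Cplx337 {α : ℝ} {v w : 𝔠.bg.Cfg} (h : 𝔠.bg.Cplx337 α v w) :
    ∃ (U : B.Cfg) (a : 𝔠.A), v = .base U ∧ w = .mult a ∧ 𝔠.C37 α U a := by
  match v, w, h with
  | .base U, .mult a, h => exact ⟨U, a, rfl, rfl, h⟩

/-- (3.38) of the coding holds ONLY at pairs `(base U, mult a)`. [cite: Balaban1985BackgroundPropagators, (3.38) p.396, bookkeeping] -/
theorem exists_of_bg_Cplx338 {α : ℝ} {v w : 𝔠.bg.Cfg} (h : 𝔠.bg.Cplx338 α v w) :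
    ∃ (U : B.Cfg) (a : 𝔠.A), v = .base U ∧ w = .mult a ∧ 𝔠.C38 α U a := by
  match v, w, h with
  | .base U, .mult a, h => exact ⟨U, a, rfl, rfl, h⟩

/-- (3.35) of the coding holds ONLY at base configurations. [cite: Balaban1985BackgroundPropagators, (3.35) p.396, bookkeeping] -/
theorem exists_of_bg_Reg335 {c α : ℝ} {v : 𝔠.bg.Cfg} (h : 𝔠.bg.Reg335 c α v) : ∃ U : B.Cfg, v = .base U ∧ B.Reg335 c α U := by
  match v, h with
  | .base U, h => exact ⟨U, rfl, h⟩

end Coding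

/-! ## §2 Pulling the record's families back along the decoding -/

section Pull

variable {g : Geometry} {B : Backgrounds} (𝔠 : Coding B)

/-- the record's kernel family READ ALONG THE DECODING: the readings at a coded configuration are those at the configuration it decodes to.
[cite: Balaban1985BackgroundPropagators, Thm 3.1 (3.42)–(3.47) pp.397–398 (the readings), Thm 3.4 p.400] -/
def pullK (K : KernelFamily g B) : KernelFamily g 𝔠.bg where
  e n c := K.e n (𝔠.dec c)
  h1 c := K.h1 (𝔠.dec c)
  e4 c := K.e4 (𝔠.dec c)
  h2 c := K.h2 (𝔠.dec c)
  l2 n c := K.l2 n (𝔠.dec c)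
  glob n c := K.glob n (𝔠.dec c)

/-- the record's two-point kernel READ ALONG THE DECODING. [cite: Balaban1985BackgroundPropagators, Thm 3.2 (3.48) p.398] -/
def pullS (C : SiteKernel g B) : SiteKernel g 𝔠.bg where
  ker c := C.ker (𝔠.dec c)

/-- the record's analyticity predicate READ ALONG THE DECODING with the `α₁`-rescaling `r`: at `base U` and exponent `β` it says «every record family
pulling back to `K′` is analytic at `U` with `α₁ = β ∕ r`»; vacuously true off the base configurations (never asked there).
[cite: Balaban1985BackgroundPropagators, Thm 3.4 p.400 («extend … as analytic functions of A»)] -/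
def pullAn (r : ℝ) (IsAn : KernelFamily g B → B.Cfg → ℝ → Prop) : KernelFamily g 𝔠.bg → 𝔠.bg.Cfg → ℝ → Prop :=
  fun K' v β => match v with
    | .base U => ∀ K : KernelFamily g B, K' = pullK 𝔠 K → IsAn K U (β / r)
    | _ => True

/-- the pulled-back readings at `base U` are the record's at `U`. [cite: Balaban1985BackgroundPropagators, (3.42) p.397, bookkeeping] -/
@[simp] theorem pullK_e (K : KernelFamily g B) (n : Fin 4) (c : 𝔠.bg.Cfg) : (pullK 𝔠 K).e n c = K.e n (𝔠.dec c) := rfl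

/-- the pulled-back kernel at a coded configuration is the record's at its decoding. [cite: Balaban1985BackgroundPropagators, (3.48) p.398, bookkeeping] -/
@[simp] theorem pullS_ker (C : SiteKernel g B) (c : 𝔠.bg.Cfg) : (pullS 𝔠 C).ker c = C.ker (𝔠.dec c) := rfl

/-- `pullK` is injective (the decoding is onto: `dec (base U) = U`). [cite: Balaban1985BackgroundPropagators, (3.42) p.397, bookkeeping] -/
theorem pullK_injective : Function.Injective (pullK (g := g) 𝔠) := by
  intro K K' h
  have he : ∀ n U, K.e n U = K'.e n U := fun n U => by
    simpa using congrArg (fun L : KernelFamily g 𝔠.bg => L.e n (.base U)) h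
  have h1 : ∀ U, K.h1 U = K'.h1 U := fun U => by
    simpa [pullK] using congrArg (fun L : KernelFamily g 𝔠.bg => L.h1 (.base U)) h
  have e4 : ∀ U, K.e4 U = K'.e4 U := fun U => by
    simpa [pullK] using congrArg (fun L : KernelFamily g 𝔠.bg => L.e4 (.base U)) h
  have h2 : ∀ U, K.h2 U = K'.h2 U := fun U => by
    simpa [pullK] using congrArg (fun L : KernelFamily g 𝔠.bg => L.h2 (.base U)) h
  have l2 : ∀ n U, K.l2 n U = K'.l2 n U := fun n U => by
    simpa [pullK] using congrArg (fun L : KernelFamily g 𝔠.bg => L.l2 n (.base U)) h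
  have gl : ∀ n U, K.glob n U = K'.glob n U := fun n U => by
    simpa [pullK] using congrArg (fun L : KernelFamily g 𝔠.bg => L.glob n (.base U)) h
  cases K; cases K'
  simp only [KernelFamily.mk.injEq]
  exact ⟨funext fun n => funext fun U => he n U, funext h1, funext e4, funext h2,
    funext fun n => funext fun U => l2 n U, funext fun n => funext fun U => gl n U⟩

/-- the pulled-back analyticity predicate at `base U` and the family `pullK K` IS the record's at `(K, U, β ∕ r)`.
[cite: Balaban1985BackgroundPropagators, Thm 3.4 p.400, bookkeeping] -/
theorem pullAn_base_iff (r : ℝ) (IsAn : KernelFamily g B → B.Cfg → ℝ → Prop) (K : KernelFamily g B) (U : B.Cfg) (β : ℝ) :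
    pullAn 𝔠 r IsAn (pullK 𝔠 K) (.base U) β ↔ IsAn K U (β / r) :=
  ⟨fun h => h K rfl, fun h K' hK' => by cases pullK_injective 𝔠 hK'; exact h⟩

/-- the (3.42)∕(3.46)∕(3.47) block of the pulled-back family at a coded configuration IS the record's at its decoding.
[cite: Balaban1985BackgroundPropagators, (3.42), (3.46), (3.47) pp.397–398, bookkeeping] -/
theorem ineq342_346_347_pull_iff (K : KernelFamily g B) (B₀ δ₀ : ℝ) (c : 𝔠.bg.Cfg) :
    Ineq342_346_347 (pullK 𝔠 K) B₀ δ₀ c ↔ Ineq342_346_347 K B₀ δ₀ (𝔠.dec c) := Iff.rfl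

/-- the (3.43)–(3.45) block of the pulled-back family at a coded configuration IS the record's at its decoding.
[cite: Balaban1985BackgroundPropagators, (3.43)–(3.45) p.398, bookkeeping] -/
theorem ineq343_345_pull_iff (K : KernelFamily g B) (Bβ Bε : ℝ → ℝ) (Bεβ : ℝ → ℝ → ℝ) (δ₀ : ℝ) (c : 𝔠.bg.Cfg) :
    Ineq343_345 (pullK 𝔠 K) Bβ Bε Bεβ δ₀ c ↔ Ineq343_345 K Bβ Bε Bεβ δ₀ (𝔠.dec c) := Iff.rfl

/-- the joint block of Theorems 3.1–3.3 of the pulled-back families at a coded configuration IS the record's at its decoding.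
[cite: Balaban1985BackgroundPropagators, Thms 3.1–3.3 pp.397–399, bookkeeping] -/
theorem thms31to33IneqAt_pull_iff (d : ℕ) (Gp GA : KernelFamily g B) (C : SiteKernel g B) (B₀ δ₀ : ℝ) (Bβ Bε : ℝ → ℝ) (Bεβ : ℝ → ℝ → ℝ)
    (B₁ δ₁ : ℝ) (c : 𝔠.bg.Cfg) :
    Thms31to33IneqAt d (pullK 𝔠 Gp) (pullK 𝔠 GA) (pullS 𝔠 C) B₀ δ₀ Bβ Bε Bεβ B₁ δ₁ c ↔
      Thms31to33IneqAt d Gp GA C B₀ δ₀ Bβ Bε Bεβ B₁ δ₁ (𝔠.dec c) := Iff.rfl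

end Pull

/-! ## §3 Transfer of the printed statements between a record and its coding -/

section Transfer

variable {I : Type} (d : ℕ) (c35 : ℝ) (geo : I → Geometry) (bg : I → Backgrounds) (𝔠 : ∀ i, Coding (bg i))
  (Gp GA : ∀ i, KernelFamily (geo i) (bg i)) (Cinv : ∀ i, SiteKernel (geo i) (bg i))
  (IsAn : ∀ i, KernelFamily (geo i) (bg i) → (bg i).Cfg → ℝ → Prop)

/-- ★ **THEOREM 3.2 TRANSFERS TO THE CODING**: (3.48) at the (3.35)-regular configurations of the record gives (3.48) at the (3.35)-regular CODED
configurations (which are the `base U` with `U` regular; the pulled-back kernel there is the record's). [cite: Balaban1985BackgroundPropagators, Thm 3.2 (3.48) p.398, (3.35) p.396] -/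
theorem thm32Printed_coded (h : Thm32Printed d c35 geo bg Cinv) :
    Thm32Printed d c35 geo (fun i => (𝔠 i).bg) (fun i => pullS (𝔠 i) (Cinv i)) := by
  obtain ⟨M₁, δ₀, a₀, B₀, hM₁, hδ₀, ha₀, hB₀, H⟩ := h
  refine ⟨M₁, δ₀, a₀, B₀, hM₁, hδ₀, ha₀, hB₀, fun i hM α₀ hα₀ hMα v hv => ?_⟩
  obtain ⟨U, rfl, hU⟩ := (𝔠 i).exists_of_bg_Reg335 hv
  exact H i hM α₀ hα₀ hMα U hU

/-- ★ **THEOREM 3.3 (WITH 3.1's BLOCK FOR G′) TRANSFERS TO THE CODING**: the blocks (3.42)–(3.47) of the record's families at the (3.35)-regular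
configurations give the same blocks of the pulled-back families at the regular coded configurations. [cite: Balaban1985BackgroundPropagators, Thm 3.3 p.399, Thm 3.1 pp.397–398, (3.35) p.396] -/
theorem thm33Printed_coded (h : Thm33Printed c35 geo bg Gp GA) :
    Thm33Printed c35 geo (fun i => (𝔠 i).bg) (fun i => pullK (𝔠 i) (Gp i)) (fun i => pullK (𝔠 i) (GA i)) := by
  obtain ⟨M₁, δ₀, a₀, B₀, Bβ, Bε, Bεβ, hM₁, hδ₀, ha₀, hB₀, H⟩ := h
  refine ⟨M₁, δ₀, a₀, B₀, Bβ, Bε, Bεβ, hM₁, hδ₀, ha₀, hB₀, fun i hM α₀ hα₀ hMα v hv => ?_⟩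
  obtain ⟨U, rfl, hU⟩ := (𝔠 i).exists_of_bg_Reg335 hv
  exact H i hM α₀ hα₀ hMα U hU

/-- ★★ **THE SECT.-B STEP TRANSFERS FROM THE CODING BACK TO THE RECORD** (Theorem 3.4's quantifier ranges, p. 400; (3.35)–(3.37) p. 396).  Suppose the
Sect.-B step holds for the pulled-back families over the coded carriers, and suppose the ONE CLASS IMPLICATION `hclass`: at every member above the
`M`-threshold `Mc`, for `0 < α₀` with `Mα₀ ≦ ac`, every (3.35)-regular `U` of the record and every `U′` in the record's class (3.37) at `0 < α₁ ≦ αcap`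
admit a code `a` of `U′` (`decA a = U′`) in the coded class `C37 (r·α₁) U a`.  Then the Sect.-B step holds for the record's families: thresholds
`max M₀ Mc`, `min (a₁ ∕ r) αcap`, `min a₀′ ac`, output constants unchanged; the step at `(U, U′)` is the coded step at `(base U, mult a)`, whose
conclusions are readings at `dec (prod U a) = U′U`; analyticity at `α₁` is the coded analyticity at `r·α₁`.
[cite: Balaban1985BackgroundPropagators, Thm 3.4 p.400, Sect. B pp.400–407, (3.35)–(3.37) p.396] -/
theorem sectBStepPrinted_of_coded {r αcap Mc ac : ℝ} (hr : 0 < r) (hcap : 0 < αcap) (hac : 0 < ac)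
    (hclass : ∀ (i : I) (α₀ α₁ : ℝ) (U U' : (bg i).Cfg), Mc ≤ (geo i).M → 0 < α₀ → (geo i).M * α₀ ≤ ac →
      (bg i).Reg335 c35 α₀ U → 0 < α₁ → α₁ ≤ αcap → (bg i).Cplx337 α₁ U U' →
      ∃ a : (𝔠 i).A, (𝔠 i).decA a = U' ∧ (𝔠 i).C37 (r * α₁) U a)
    (h : SectBStepPrinted d c35 geo (fun i => (𝔠 i).bg) (fun i => pullK (𝔠 i) (Gp i)) (fun i => pullK (𝔠 i) (GA i))
      (fun i => pullS (𝔠 i) (Cinv i)) (fun i => pullAn (𝔠 i) r (IsAn i))) :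
    SectBStepPrinted d c35 geo bg Gp GA Cinv IsAn := by
  intro B₀ δ₀ Bβ Bε Bεβ B₁ δ₁
  obtain ⟨M₀, a₁, a₀', B₀', δ₀', Bβ', Bε', Bεβ', B₁', δ₁', hM₀, ha₁, ha₀', hB₀', hδ₀', hB₁', hδ₁', H⟩ := h B₀ δ₀ Bβ Bε Bεβ B₁ δ₁
  refine ⟨max M₀ Mc, min (a₁ / r) αcap, min a₀' ac, B₀', δ₀', Bβ', Bε', Bεβ', B₁', δ₁', lt_max_of_lt_left hM₀,
    lt_min (div_pos ha₁ hr) hcap, lt_min ha₀' hac, hB₀', hδ₀', hB₁', hδ₁', fun i hM α₀ hα₀ hMα U hU hT α₁ hα₁ hα₁a => ?_⟩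
  have hM0 : M₀ ≤ (geo i).M := le_trans (le_max_left _ _) hM
  have hMc : Mc ≤ (geo i).M := le_trans (le_max_right _ _) hM
  have hMa : (geo i).M * α₀ ≤ a₀' := le_trans hMα (min_le_left _ _)
  have hMac : (geo i).M * α₀ ≤ ac := le_trans hMα (min_le_right _ _)
  have hrα : 0 < r * α₁ := mul_pos hr hα₁
  have hrα₁ : r * α₁ ≤ a₁ := by
    have h1 : α₁ ≤ a₁ / r := le_trans hα₁a (min_le_left _ _)
    calc r * α₁ ≤ r * (a₁ / r) := mul_le_mul_of_nonneg_left h1 hr.le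
      _ = a₁ := mul_div_cancel₀ a₁ hr.ne'
  have hαcap : α₁ ≤ αcap := le_trans hα₁a (min_le_right _ _)
  have hTc : Thms31to33IneqAt d (pullK (𝔠 i) (Gp i)) (pullK (𝔠 i) (GA i)) (pullS (𝔠 i) (Cinv i)) B₀ δ₀ Bβ Bε Bεβ B₁ δ₁ (.base U) :=
    (thms31to33IneqAt_pull_iff (𝔠 i) d (Gp i) (GA i) (Cinv i) B₀ δ₀ Bβ Bε Bεβ B₁ δ₁ (.base U)).2 hT
  obtain ⟨hAp, hAA, Hprod⟩ := H i hM0 α₀ hα₀ hMa (.base U) ((𝔠 i).bg_Reg335_base c35 α₀ U |>.2 hU) hTc (r * α₁) hrα hrα₁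
  have hdiv : r * α₁ / r = α₁ := by field_simp
  refine ⟨?_, ?_, fun U' hU' => ?_⟩
  · simpa [hdiv] using (pullAn_base_iff (𝔠 i) r (IsAn i) (Gp i) U (r * α₁)).1 hAp
  · simpa [hdiv] using (pullAn_base_iff (𝔠 i) r (IsAn i) (GA i) U (r * α₁)).1 hAA
  · obtain ⟨a, ha, hC⟩ := hclass i α₀ α₁ U U' hMc hα₀ hMac hU hα₁ hαcap hU'
    have key := Hprod (.mult a) (((𝔠 i).bg_Cplx337_base_mult (r * α₁) U a).2 hC)
    rw [thms31to33IneqAt_pull_iff] at key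
    simpa [ha] using key

end Transfer

end Literature.MathematicalPhysics.QuantumFieldTheory.Balaban1983to89.B9SectBCodedCarrier
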